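import Literature.Computability.AlgebraicComplexity.ConstantFreeValiant
import Literature.Computability.AlgebraicComplexity.TauConjectureProofs
import HarnessLib

/-!
# Bürgisser's transfer `τ(Per) = n^{O(1)} ⇒ τ(2^{e(n)} f_n) = (log n)^{O(1)}`: the two algebraic inputs

Bürgisser, *On defining integers and proving arithmetic circuit lower bounds* (Comput.
Complexity 18 (2009) = ECCC TR06-113; ECCC numbering quoted), proves Thm. 4.1(2) — the
hypothesis `Burgisser2009_thm41_2(_uniform)` of the tree's conditional proof of his main theorem
(`TauConjectureProofs.lean`) — from four ingredients: Lemma 2.12 and Lemma 2.5(2) (Boolean: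
`τ(Per) = n^{O(1)} ⇒ CH ⊆ P/poly`, vendored in `TauConjectureProofs.lean`/`CountingHierarchy.lean`)
and two results on the constant-free Valiant classes `VP⁰ ⊆ VNP⁰` (`ConstantFreeValiant.lean`),
vendored here as named facts (D-0014):

* `Burgisser2009_thm210` — **Thm. 2.10** (= Koiran 2004, Thm. 4.3 in `τ`-form): if
  `τ(Per_n) = n^{O(1)}` then for every family `(f_n) ∈ VNP⁰` there is a polynomially bounded
  `(p(n))` with `τ(2^{p(n)} f_n) = n^{O(1)}` (inspection of the VNP-completeness proof of `PER`:
  constants `∈ {-1, -1/2, 0, 1/2, 1}`, then homogeneity);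
* `Burgisser2009_thm41_koiranStep` — the application of **Thm. 2.11** (= Koiran 2004, Thm. 6.1,
  the "generalized Valiant criterion", binary encoding of the indices) displayed in the proof of
  Thm. 4.1(2), p. 14–15: for `p, q` polynomially bounded with `p(n) ≥ n` and a 0/1 array
  `b(n, k, j)` (`k ≤ q(n)`, `j ≤ p(n)`) decidable in `P/poly`, the two-block interpolating
  polynomials
  `B_n(Y, Z) = ∑_{j ≤ p(n)} ∑_{k ≤ q(n)} b(n,k,j) Y_1^{j_1}⋯Y_ℓ^{j_ℓ} Z_1^{k_1}⋯Z_λ^{k_λ}`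
  (`ℓ = 1 + ⌊log₂ p(n)⌋`, `λ = 1 + ⌊log₂ q(n)⌋`, `j_i, k_i` the bits) are the projections
  `B_n(Y, Z) = G_{ℓ,λ}((Y, Z), (n_1, …, n_{ℓ+λ}), (p_1, …, p_ℓ), (q_1, …, q_λ))` of ONE family
  `(G_{ℓ,λ}) ∈ VNP⁰` (see the docstring of the fact for the indexing by the pair `(ℓ, λ)`).

Definitions (with bodies) of the objects in these statements: `bitLen m = 1 + ⌊log₂ m⌋`,
`bitMonomial r j = X_1^{j_1} ⋯ X_r^{j_r}`, `twoBlockPoly p q b n = B_n`, the variable type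
`KoiranVars ℓ λ` of `G_{ℓ,λ}` and the substitution `blockSubst p q n` of p. 15. Proved API:
`lt_two_pow_bitLen`, `aeval_bitMonomial`,
`prod_pow_two_pow_testBit` (`∏ᵢ (c^{2^i})^{j_i} = c^j` for `j < 2^r`, the identity behind
`B_n(2^{2^0}, …, 2^{2^{ℓ-1}}, X^{2^0}, …, X^{2^{λ-1}}) = ∑_k b(n,k) X^k`), `sum_testBit_two_pow`
(binary expansion below `2^r`), and `aeval_twoBlockPoly_powers` (the displayed specialisation of
`B_n`, p. 14). The assembly of Thm. 4.1(2) from these facts is `BurgisserTransferProofs.lean`.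

## References

* P. Bürgisser, *On defining integers and proving arithmetic circuit lower bounds*, Comput.
  Complexity 18 (2009) 81–103 = ECCC TR06-113, Thm. 2.10, Thm. 2.11, proof of Thm. 4.1 (p. 14–15).
* P. Koiran, *Valiant's model and the cost of computing integers*, Comput. Complexity 13 (2004)
  131–146, Thm. 4.3, Thm. 6.1 (generalized Valiant criterion), Cor. 6.5.
-/

noncomputable section

open MvPolynomial Computability Literature.Computability.Complexity

namespace Literature.Computability.AlgebraicComplexity

/-! ### Bit lengths, bit monomials, the two-block interpolating polynomial -/

/-- `bitLen m = 1 + ⌊log₂ m⌋`, the number of binary digits Bürgisser uses for indices `≤ m`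
(`ℓ(n) = 1 + ⌊log p(n)⌋`, `λ(n) = 1 + ⌊log q(n)⌋`; ECCC TR06-113, Thm. 2.11 and p. 14). [cite: Burgisser2006, Thm. 2.11] -/
def bitLen (m : ℕ) : ℕ :=
  Nat.log 2 m + 1

/-- Every index `≤ m` (indeed `m` itself) fits into `bitLen m` binary digits. [cite: Burgisser2006, Thm. 2.11] -/
theorem lt_two_pow_bitLen (m : ℕ) : m < 2 ^ bitLen m :=
  Nat.lt_pow_succ_log_self one_lt_two m

/-- `bitLen` is monotone. [folklore] -/
theorem bitLen_mono {m m' : ℕ} (h : m ≤ m') : bitLen m ≤ bitLen m' :=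
  Nat.succ_le_succ (Nat.log_mono_right h)

/-- `bitLen m ≤ m + 1`. [folklore] -/
theorem bitLen_le (m : ℕ) : bitLen m ≤ m + 1 :=
  Nat.succ_le_succ (Nat.log_le_self 2 m)

/-- The **bit monomial** `X_1^{j_1} ⋯ X_r^{j_r}` of an index `j`, where `j_i` is the bit of `j` of
weight `2^{i-1}` (variables indexed by `Fin r`, bit `i` for `X i`; ECCC TR06-113, Prop. 2.9,
Thm. 2.11; Koiran 2004, (6.2)). [cite: Burgisser2006, Thm. 2.11] -/
def bitMonomial (r j : ℕ) : MvPolynomial (Fin r) ℤ :=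
  ∏ i : Fin r, X i ^ (j.testBit i).toNat

/-- Bürgisser's **two-block interpolating polynomial** of a 0/1 array `b(n, k, j)`:
`B_n(Y_1, …, Y_ℓ, Z_1, …, Z_λ) = ∑_{j=0}^{p(n)} ∑_{k=0}^{q(n)} b(n,k,j) Y_1^{j_1}⋯Y_ℓ^{j_ℓ} Z_1^{k_1}⋯Z_λ^{k_λ}`
with `ℓ = bitLen (p n)`, `λ = bitLen (q n)` (ECCC TR06-113, proof of Thm. 4.1(2), p. 14; the
`Y`-variables are `Sum.inl`, the `Z`-variables `Sum.inr`). [cite: Burgisser2006, proof of Thm. 4.1(2)] -/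
def twoBlockPoly (p q : ℕ → ℕ) (b : ℕ → ℕ → ℕ → Bool) (n : ℕ) :
    MvPolynomial (Fin (bitLen (p n)) ⊕ Fin (bitLen (q n))) ℤ :=
  ∑ j ∈ Finset.range (p n + 1), ∑ k ∈ Finset.range (q n + 1),
    if b n k j then rename Sum.inl (bitMonomial (bitLen (p n)) j) *
      rename Sum.inr (bitMonomial (bitLen (q n)) k) else 0

/-- The variables of Koiran's family `G_{ℓ,λ}`: the block `(Y, Z)` (`Fin ℓ ⊕ Fin λ`, to be
specialised to the variables of `B_n`), the block `N` of `ℓ + λ` digit variables (to the bits of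
`n`), and the blocks `P`, `Q` (`Fin ℓ ⊕ Fin λ`, to the bits of `p(n)` and `q(n)`)
(ECCC TR06-113, Thm. 2.11 and p. 15; Koiran 2004, Thm. 6.1). [cite: Burgisser2006, proof of Thm. 4.1(2)] -/
abbrev KoiranVars (ℓ μ : ℕ) : Type :=
  (Fin ℓ ⊕ Fin μ) ⊕ Fin (ℓ + μ) ⊕ (Fin ℓ ⊕ Fin μ)

/-- The substitution of p. 15: the block `(Y, Z)` of `G_{ℓ,λ}` goes to the variables of `B_n`,
the block `N` to the bits `n_1, …, n_{ℓ+λ}` of `n`, the blocks `P`, `Q` to the bits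
`p_1, …, p_ℓ` of `p(n)` and `q_1, …, q_λ` of `q(n)` (bit `i` = weight `2^i`, as `0/1` constants)
(ECCC TR06-113, proof of Thm. 4.1(2), display on p. 15). [cite: Burgisser2006, proof of Thm. 4.1(2)] -/
def blockSubst (p q : ℕ → ℕ) (n : ℕ) :
    KoiranVars (bitLen (p n)) (bitLen (q n)) →
      MvPolynomial (Fin (bitLen (p n)) ⊕ Fin (bitLen (q n))) ℤ :=
  Sum.elim X (Sum.elim (fun i => C ((n.testBit i).toNat : ℤ))
    (Sum.elim (fun i => C (((p n).testBit i).toNat : ℤ)) fun i => C (((q n).testBit i).toNat : ℤ)))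

/-! ### The two vendored facts -/

/-- **Bürgisser's Theorem 2.10** (= Koiran 2004, Thm. 4.3, in `τ`-form): suppose
`τ(Per_n) = n^{O(1)}`; then for any family `(f_n) ∈ VNP⁰` there exists a polynomially bounded
sequence `(p(n))` in `ℕ` such that `τ(2^{p(n)} f_n) = n^{O(1)}`. (Proof in the source: by
inspection of Valiant's completeness proof every `VNP⁰` family is a projection
`f_n = Per_{p(n)}(y)` with `y_i` variables or constants in `{-1, -1/2, 0, 1/2, 1}`; by homogeneity
`2^{p(n)} f_n = Per_{p(n)}(2y)`.) Rendering: `τ = constantFreeComplexity`, `Per_n = perPoly (Fin n) ℤ`,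
families indexed by `n` in p-bounded variable types `σ n` (`IsVNP0Family`). [cite: Burgisser2006, Thm. 2.10] -/
def Burgisser2009_thm210 : Prop :=
  IsPBounded (fun n => constantFreeComplexity (perPoly (Fin n) ℤ)) →
    ∀ (σ : ℕ → Type) [∀ n, Fintype (σ n)] (f : ∀ n, MvPolynomial (σ n) ℤ), IsVNP0Family f →
      ∃ p : ℕ → ℕ, IsPBounded p ∧
        IsPBounded fun n => constantFreeComplexity (C ((2 : ℤ) ^ p n) * f n)

/-- **The application of Bürgisser's Theorem 2.11 (= Koiran 2004, Thm. 6.1) in the proof of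
Thm. 4.1(2)** (ECCC TR06-113, p. 14–15, the display "By Theorem 2.11 there is a family
`(G_r((X_1,…,X_r),(N_1,…,N_r),(P_1,…,P_r)))` in `VNP⁰` that satisfies for all `n`:
`B_n(Y, Z) = G_{ℓ(n)+λ(n)}((Y, Z), (n_1,…,n_{ℓ(n)+λ(n)}), (p_1,…,p_{ℓ(n)}, q_1,…,q_{λ(n)}))`"):
for `p, q : ℕ → ℕ` polynomially bounded with `p(n) ≥ n` (the standing "w.l.o.g." of the proof and
the hypothesis of Thm. 2.11) and a 0/1 array `b(n, k, j)` such that "`b(n,k,j) = 1`" is decidable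
in `P/poly` on the index domain `k ≤ q(n)`, `j ≤ p(n)` — rendered with the query encoding
`encBitQuery n k j true` of Def. 3.1 (`TauConjectureProofs.lean`): some `B ∈ PPoly` has
`encBitQuery n k j true ∈ B ↔ b n k j` there — the two-block polynomials `B_n = twoBlockPoly p q b n`
are the substitution instances `blockSubst p q n` of one `VNP⁰` family `G` at the member with
`ℓ = bitLen (p n)`, `λ = bitLen (q n)`.

Rendering note (indexing). The member of `G` used for `B_n` must know where the `Y`-block ends
and the `Z`-block begins. In the source this split `ℓ(n)` is a function of `n` that the
construction can evaluate because there `p(n) = n^c` is the explicit bit bound of condition (4);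
for an arbitrary polynomially bounded `p` it is not determined by `ℓ + λ` and the data fed to
`G_{ℓ+λ}`. We therefore index the family by the pair, `G_{ℓ,λ}` (as an `ℕ`-indexed family through
`Nat.unpair`, which preserves polynomial bounds), with variable blocks
`KoiranVars ℓ λ = (Y, Z) ⊕ N ⊕ (P ⊕ Q)`; for the source's `p` this is the displayed statement.
Koiran's Thm. 6.1 is printed for one block of index digits and `#P/poly` coefficient functions;
its proof — arithmetisation of the `P/poly` predicate as a Boolean sum of a `VP⁰` family, the
`VP⁰` comparison polynomials `C_r(J, P)`, Boolean summation over the digit variables — covers the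
two-block 0/1 case verbatim, which is how Bürgisser applies it. [cite: Burgisser2006, proof of Thm. 4.1(2), p. 14–15 (via Thm. 2.11 = Koiran2004 Thm. 6.1)] -/
def Burgisser2009_thm41_koiranStep : Prop :=
  ∀ (p q : ℕ → ℕ), IsPBounded p → IsPBounded q → (∀ n, n ≤ p n) →
    ∀ (b : ℕ → ℕ → ℕ → Bool),
      (∃ B ∈ PPoly, ∀ n k j, k ≤ q n → j ≤ p n → (encBitQuery n k j true ∈ B ↔ b n k j = true)) →
        ∃ G : ∀ ℓ μ : ℕ, MvPolynomial (KoiranVars ℓ μ) ℤ,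
          IsVNP0Family (σ := fun r => KoiranVars (Nat.unpair r).1 (Nat.unpair r).2)
              (fun r => G (Nat.unpair r).1 (Nat.unpair r).2) ∧
            ∀ n, twoBlockPoly p q b n = aeval (blockSubst p q n) (G (bitLen (p n)) (bitLen (q n)))

/-! ### API: evaluating bit monomials at iterated squares -/

/-- `aeval g (X_1^{j_1} ⋯ X_r^{j_r}) = ∏ᵢ (g i)^{j_i}`. [folklore] -/
theorem aeval_bitMonomial {A : Type*} [CommRing A] [Algebra ℤ A] {r : ℕ} (g : Fin r → A) (j : ℕ) :
    aeval g (bitMonomial r j) = ∏ i : Fin r, g i ^ (j.testBit i).toNat := by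
  simp [bitMonomial, map_prod]

/-- Renaming then evaluating a bit monomial. [folklore] -/
theorem aeval_rename_bitMonomial {A : Type*} [CommRing A] [Algebra ℤ A] {r : ℕ} {ι : Type*}
    (e : Fin r → ι) (g : ι → A) (j : ℕ) :
    aeval g (rename e (bitMonomial r j)) = ∏ i : Fin r, g (e i) ^ (j.testBit i).toNat := by
  rw [aeval_rename, aeval_bitMonomial]
  rfl

/-- **Binary expansion below `2^r`**: `∑_{i<r} 2^i · j_i = j % 2^r`. [folklore] -/
theorem sum_two_pow_mul_testBit (j r : ℕ) :
    ∑ i ∈ Finset.range r, 2 ^ i * (j.testBit i).toNat = j % 2 ^ r := by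
  induction r with
  | zero => simp [Nat.mod_one]
  | succ r ih =>
    rw [Finset.sum_range_succ, ih, Nat.mod_pow_succ, Nat.toNat_testBit]

/-- Binary expansion of `j < 2^r`: `∑_{i<r} 2^i · j_i = j`. [folklore] -/
theorem sum_two_pow_mul_testBit_of_lt {j r : ℕ} (h : j < 2 ^ r) :
    ∑ i ∈ Finset.range r, 2 ^ i * (j.testBit i).toNat = j := by
  rw [sum_two_pow_mul_testBit, Nat.mod_eq_of_lt h]

/-- **Iterated squares realise bit monomials**: `∏_{i<r} (c^{2^i})^{j_i} = c^{j % 2^r}`, hence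
`= c^j` for `j < 2^r` — the identity behind `A_n(2^{2^0}, …, 2^{2^{ℓ-1}}) = a(n)` and
`B_n(…, X^{2^0}, …, X^{2^{λ-1}}) = f_n` (ECCC TR06-113, p. 14). [cite: Burgisser2006, proof of Thm. 4.1] -/
theorem prod_pow_two_pow_testBit {M : Type*} [CommMonoid M] (c : M) (r j : ℕ) :
    ∏ i : Fin r, (c ^ 2 ^ (i : ℕ)) ^ (j.testBit i).toNat = c ^ (j % 2 ^ r) := by
  rw [← sum_two_pow_mul_testBit, ← Finset.prod_pow_eq_pow_sum,
    ← Fin.prod_univ_eq_prod_range (fun i => c ^ (2 ^ i * (j.testBit i).toNat)) r]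
  refine Finset.prod_congr rfl fun i _ => ?_
  rw [pow_mul]

/-- The case `j < 2^r`. [cite: Burgisser2006, proof of Thm. 4.1] -/
theorem prod_pow_two_pow_testBit_of_lt {M : Type*} [CommMonoid M] (c : M) {r j : ℕ} (h : j < 2 ^ r) :
    ∏ i : Fin r, (c ^ 2 ^ (i : ℕ)) ^ (j.testBit i).toNat = c ^ j := by
  rw [prod_pow_two_pow_testBit, Nat.mod_eq_of_lt h]

/-- **The displayed specialisation of `B_n`** (ECCC TR06-113, p. 14): substituting
`Y_i ↦ y^{2^{i-1}}` and `Z_i ↦ x^{2^{i-1}}` in `B_n` gives `∑_{k ≤ q(n)} (∑_{j ≤ p(n)} b(n,k,j) y^j) x^k`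
in any commutative `ℤ`-algebra (`y = 2` in the source). [cite: Burgisser2006, proof of Thm. 4.1(2)] -/
theorem aeval_twoBlockPoly_powers {A : Type*} [CommRing A] [Algebra ℤ A] (p q : ℕ → ℕ)
    (b : ℕ → ℕ → ℕ → Bool) (n : ℕ) (y x : A) :
    aeval (Sum.elim (fun i : Fin (bitLen (p n)) => y ^ 2 ^ (i : ℕ))
        (fun i : Fin (bitLen (q n)) => x ^ 2 ^ (i : ℕ))) (twoBlockPoly p q b n) =
      ∑ k ∈ Finset.range (q n + 1),
        (∑ j ∈ Finset.range (p n + 1), if b n k j then y ^ j else 0) * x ^ k := by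
  simp only [twoBlockPoly, map_sum]
  rw [Finset.sum_comm]
  refine Finset.sum_congr rfl fun k hk => ?_
  rw [Finset.sum_mul]
  refine Finset.sum_congr rfl fun j hj => ?_
  have hj' : j < 2 ^ bitLen (p n) :=
    lt_of_le_of_lt (Nat.lt_succ_iff.1 (Finset.mem_range.1 hj)) (lt_two_pow_bitLen _)
  have hk' : k < 2 ^ bitLen (q n) :=
    lt_of_le_of_lt (Nat.lt_succ_iff.1 (Finset.mem_range.1 hk)) (lt_two_pow_bitLen _)
  split_ifs with hb
  · rw [map_mul, aeval_rename_bitMonomial, aeval_rename_bitMonomial]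
    simp only [Sum.elim_inl, Sum.elim_inr]
    rw [prod_pow_two_pow_testBit_of_lt y hj', prod_pow_two_pow_testBit_of_lt x hk']
  · simp

/-- **Reading off an integer from its bits** (the inner sum above with `y = 2`): for
`m < 2^{N}`, `∑_{j<N} [bit_j(m)] 2^j = m`, in any ring. [folklore] -/
theorem sum_ite_testBit_two_pow {A : Type*} [CommRing A] {m N : ℕ} (h : m < 2 ^ N) :
    (∑ j ∈ Finset.range N, if m.testBit j then (2 : A) ^ j else 0) = (m : A) := by
  have key : ∀ j, (if m.testBit j then (2 : A) ^ j else 0) = ((2 ^ j * (m.testBit j).toNat : ℕ) : A) := by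
    intro j
    cases m.testBit j <;> simp
  simp_rw [key]
  rw [← Nat.cast_sum, sum_two_pow_mul_testBit_of_lt h]

end Literature.Computability.AlgebraicComplexity
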